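import Literature.Geometry.Kaehler.ComplexTorusLefschetzSL2ActionStrings
import Literature.Geometry.Kaehler.ComplexTorusLefschetzDecomposition
import Mathlib.RepresentationTheory.Invariants
import HarnessLib

/-!
# The `SL₂(ℂ)`-invariants of `H•(X; ℂ)` under Beauville's action, as a `Representation.invariants` submodule:
# they are the middle primitive classes `Pᵍ(η)`, of dimension `C(2g, g) − C(2g, g−2)`

Layer `Literature/Geometry/Kaehler`, namespace `Literature.Geometry.Kaehler.ComplexTorus`; lane `lit-hodgefound` (Track 2 foundations
library), prover seat `lit-hodgefound-p09` (generation 52, row g52-#11). THEOREMS ONLY (no definition, no named fact, no instance, no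
notation; D-0026 net debt `0`). Sequel of row g52-#7 `ComplexTorusLefschetzSL2ActionStrings` (`forall_sl2Rep_apply_eq_self_iff`: `ρ(γ) x = x ∀ γ ⟺
x = of g α`, `α ∈ Pᵍ(η)` — Bourbaki's Theorem 2 (iii)) and of `ComplexTorusLefschetzDecomposition` (`dim Pᵏ + C(2g, k−2) = C(2g, k)`).

SETTING. `ρ = (hasLefschetzProperty_lefschetzG hη).sl2Rep isZGrading_countingG : SL(2, ℂ) →* End_ℂ(GForm E ℂ)` is literally a Mathlib
`Representation ℂ SL(2, ℂ) (GForm E ℂ)`; its invariants are Mathlib's `Representation.invariants ρ` (`mem_invariants : v ∈ invariants ρ ↔ ∀ g, ρ g v = v`).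
The homogeneous class `of g α` is Mathlib's `LinearMap.single ℂ _ g α` (`GForm.of = Pi.single`).

## What is proved

* `mem_sl2Rep_invariants_iff` (`x ∈ H•(X; ℂ)^{SL₂} ⟺ x = of g α` with `α ∈ Pᵍ(η)`), `of_mem_sl2Rep_invariants` / `of_mem_sl2Rep_invariants_iff`,
  `sl2Rep_invariants_eq_map_primitiveForms` (`H•(X; ℂ)^{SL₂} = Pᵍ(η)` placed in degree `g`);
* **`finrank_sl2Rep_invariants`: `dim H•(X; ℂ)^{SL₂} = dim Pᵍ(η)`** — the multiplicity of the trivial representation ("`CH(A)` is a direct sum of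
  subrepresentations of this type": the strings of length `1` are those of the middle primitive classes);
* **`finrank_sl2Rep_invariants_add_choose`: `dim H•(X; ℂ)^{SL₂} + C(2g, g−2) = C(2g, g)` for `g ≥ 2`**, `finrank_sl2Rep_invariants_of_finrank_eq_one`
  (`g = 1`: the invariants are `H¹(X; ℂ)`, of dimension `2`).

## Sources

* N. Bourbaki, *Lie Groups and Lie Algebras, Chapters 7–9* [Bourbaki2008LieGroups79], Ch. VIII §1 no. 4 Theorem 2 (iii): "`π(s)x = x` for all `s ∈ SL(2, k)`
  if and only if `x` is invariant under `ρ`"; no. 3 Proposition 4 (the primitive vectors `P_m`).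
* A. Beauville, *The action of SL₂ on abelian varieties* (2010) [Beauville2010SL2], held text `paper:arxiv-0805.1541` p0006 L10–L13, §5 Proposition:
  "(`z, θz, …, θ^{g+s−2p} z`) is a basis of an irreducible subrepresentation of `CH(A)`. The vector space `CH(A)` is a direct sum of
  subrepresentations of this type."
* H. Lange, *Abelian Varieties over the Complex Numbers* (2023) [Lange2023AbelianVarietiesComplex], §7.3.2 (3) (`dim Pᵏ = C(2g, k) − C(2g, k−2)`).
-/

noncomputable section

-- `Module ℂ` / `SMulZeroClass ℂ` synthesis on `E [⋀^Fin k]→L[ℝ] ℂ` (as in `ComplexTorusLefschetzDecomposition`)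
set_option maxSynthPendingDepth 3

namespace Literature.Geometry.Kaehler

namespace ComplexTorus

open Module Function Finset
open scoped MatrixGroups
open Literature.LinearAlgebra.Alternating Literature.Algebra.Lie

universe uE

variable {E : Type uE} [NormedAddCommGroup E] [NormedSpace ℂ E] [FiniteDimensional ℂ E] [Nontrivial E] {η : E [⋀^Fin 2]→L[ℝ] ℝ}
  (hη : ∀ v : E, v ≠ 0 → ∃ w : E, η ![v, w] ≠ 0)
include hη

/-- **`x ∈ H•(X; ℂ)^{SL₂} ⟺ x = of g α` with `α ∈ Pᵍ(η)`** (Mathlib's `Representation.invariants` of Beauville's `ρ`).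
[cite: Bourbaki2008LieGroups79, Ch. VIII §1 no. 4 Theorem 2 (iii)] [cite: Beauville2010SL2, §5 Proposition (p. 6)] -/
theorem mem_sl2Rep_invariants_iff (x : GForm E ℂ) :
    x ∈ Representation.invariants ((hasLefschetzProperty_lefschetzG hη).sl2Rep isZGrading_countingG) ↔
      ∃ α ∈ primitiveForms η (finrank ℂ E), x = GForm.of (finrank ℂ E) α := by
  rw [Representation.mem_invariants]
  exact forall_sl2Rep_apply_eq_self_iff hη x

/-- `of g α` is `SL₂(ℂ)`-invariant for `α ∈ Pᵍ(η)`. [cite: Bourbaki2008LieGroups79, Ch. VIII §1 no. 4 Theorem 2 (iii)] -/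
theorem of_mem_sl2Rep_invariants {α : E [⋀^Fin (finrank ℂ E)]→L[ℝ] ℂ} (hα : α ∈ primitiveForms η (finrank ℂ E)) :
    GForm.of (finrank ℂ E) α ∈ Representation.invariants ((hasLefschetzProperty_lefschetzG hη).sl2Rep isZGrading_countingG) :=
  (mem_sl2Rep_invariants_iff hη _).2 ⟨α, hα, rfl⟩

/-- `of g α` is `SL₂(ℂ)`-invariant iff `α ∈ Pᵍ(η)`. [cite: Bourbaki2008LieGroups79, Ch. VIII §1 no. 4 Theorem 2 (iii)] -/
theorem of_mem_sl2Rep_invariants_iff (α : E [⋀^Fin (finrank ℂ E)]→L[ℝ] ℂ) :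
    GForm.of (finrank ℂ E) α ∈ Representation.invariants ((hasLefschetzProperty_lefschetzG hη).sl2Rep isZGrading_countingG) ↔
      α ∈ primitiveForms η (finrank ℂ E) := by
  rw [mem_sl2Rep_invariants_iff hη]
  refine ⟨?_, fun hα ↦ ⟨α, hα, rfl⟩⟩
  rintro ⟨β, hβ, hαβ⟩
  rwa [GForm.of_injective _ hαβ]

/-- **`H•(X; ℂ)^{SL₂} = Pᵍ(η)` placed in degree `g`**: `invariants ρ = (Pᵍ(η)).map (single g)` (`GForm.of g = Pi.single g = LinearMap.single ℂ _ g`).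
[cite: Bourbaki2008LieGroups79, Ch. VIII §1 no. 4 Theorem 2 (iii) and no. 3 Proposition 4] -/
theorem sl2Rep_invariants_eq_map_primitiveForms :
    Representation.invariants ((hasLefschetzProperty_lefschetzG hη).sl2Rep isZGrading_countingG) =
      (primitiveForms η (finrank ℂ E)).map (LinearMap.single ℂ (fun m : ℕ ↦ E [⋀^Fin m]→L[ℝ] ℂ) (finrank ℂ E)) := by
  ext x
  rw [mem_sl2Rep_invariants_iff hη, Submodule.mem_map]
  constructor
  · rintro ⟨α, hα, rfl⟩
    exact ⟨α, hα, rfl⟩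
  · rintro ⟨α, hα, rfl⟩
    exact ⟨α, hα, rfl⟩

/-- **`dim H•(X; ℂ)^{SL₂} = dim Pᵍ(η)`**: the multiplicity of the trivial representation in `H•(X; ℂ)` is the number of independent middle primitive
classes (the strings of length one). [cite: Beauville2010SL2, §5 Proposition (p. 6)] [cite: Bourbaki2008LieGroups79, Ch. VIII §1 no. 4 Theorem 2 (iii)] -/
theorem finrank_sl2Rep_invariants :
    finrank ℂ (Representation.invariants ((hasLefschetzProperty_lefschetzG hη).sl2Rep isZGrading_countingG)) =
      finrank ℂ (primitiveForms η (finrank ℂ E)) := by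
  rw [sl2Rep_invariants_eq_map_primitiveForms hη]
  exact (Submodule.equivMapOfInjective _ (fun a b hab ↦ GForm.of_injective (V := E) (F := ℂ) (finrank ℂ E) hab) (primitiveForms η (finrank ℂ E))).finrank_eq.symm

/-- **`dim H•(X; ℂ)^{SL₂} + C(2g, g−2) = C(2g, g)` for `g ≥ 2`** (`dim Pᵍ = C(2g, g) − C(2g, g−2)`).
[cite: Lange2023AbelianVarietiesComplex, §7.3.2 (3)] [cite: Beauville2010SL2, §5 Proposition (p. 6)] -/
theorem finrank_sl2Rep_invariants_add_choose (hg : 2 ≤ finrank ℂ E) :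
    finrank ℂ (Representation.invariants ((hasLefschetzProperty_lefschetzG hη).sl2Rep isZGrading_countingG)) +
        (2 * finrank ℂ E).choose (finrank ℂ E - 2) = (2 * finrank ℂ E).choose (finrank ℂ E) := by
  rw [finrank_sl2Rep_invariants hη]
  exact finrank_primitiveForms_add_choose hη (show 2 * 1 + (finrank ℂ E - 2) = finrank ℂ E by omega) le_rfl

/-- **`g = 1` (elliptic curves): `dim H•(X; ℂ)^{SL₂} = 2`** — the invariants are `H¹(X; ℂ) = P¹` (`C(2, 1) = 2`).
[cite: Lange2023AbelianVarietiesComplex, §7.3.2] [cite: Beauville2010SL2, §5 Proposition (p. 6)] -/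
theorem finrank_sl2Rep_invariants_of_finrank_eq_one (hg : finrank ℂ E = 1) :
    finrank ℂ (Representation.invariants ((hasLefschetzProperty_lefschetzG hη).sl2Rep isZGrading_countingG)) = 2 := by
  rw [finrank_sl2Rep_invariants hη, hg, finrank_primitiveForms_of_le_one η le_rfl, hg]
  rfl

end ComplexTorus

end Literature.Geometry.Kaehler

end
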